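import Literature.NumberTheory.LFunctions.VinogradovZetaSumCore
import HarnessLib

/-!
# The Vinogradov–Korobov bound for `U(n) = |∑_{x,y ≤ a} e(∑ α_m(n) (xy)^m)|` from the mean value theorem

Topic `Literature/NumberTheory/LFunctions`.  Everything in this file is PROVED; no definitions, no named facts.

This is the analytic heart of the proof of Theorem 6.2 of A. Ivić, *The Riemann Zeta-Function* (Wiley 1985),
§6.3, pp. 122–124: with `Y = log t/log N ≥ 10.5`, `Y² ≤ log N`, `r = ⌊5.05 Y⌋ + 1`, `k = 7r²`, `a = ⌊N^{2/5}⌋`,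
`n ∈ (N, 2N]`, `0 < u ≤ 1` and the coefficients `α_m(n) = (−1)^m t/(2πm(n+u)^m)` of `VinogradovZetaSumShift.lean`,

  `U(n) = |∑_{x ≤ a} ∑_{y ≤ a} e(∑_{m ≤ r} α_m(n) (xy)^m)| ≤ a² exp(−log N/(2·10⁶ Y²))`     (`U_bound`)

for `log N ≥ ℓ₀(A)`, assuming Vinogradov's mean value theorem in the form of Ivić's Lemma 6.3 with constant `A`
(spelled out as the hypothesis `hV` of `U_bound`; it is literally `VMVTBound A` of
`VinogradovMeanValueHypothesis.lean`, Ivić's Lemma 6.3 being `A = 4`).  Ingredients: the core bound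
`U^{4k²} ≤ a^{8k²−4k} J_{k,r}(a)² ∏_m G_m` (`VinogradovZetaSum.core_bound`), the mean value theorem with
`ρ = 6r` (`J_{k,r}(a) ≤ (Ar)^{42Ar³} a^{2k − ½(r²+r)(1 − (1−1/r)^{6r})}`), the trivial bound `G_m ≤ (2ka^m+1)²`,
and for the `≈ Y` "good" exponents `3Y < m ≤ 4Y` the bound `G_m ≤ 24 Q_m (1 + log(Q_m + 1))`,
`Q_m = 2πm(n+u)^m/t` (Lemma 6.5 with `α_m = ±1/Q_m`, `q_m = ⌊Q_m⌋`; Ivić pp. 122–123), which saves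
`N^{m/5} t^{-1} ≤ N^{−Y/5}` per good index.  Constants are crude (Ivić's `100000` becomes `2·10⁶`; `R = 6`
iterations instead of `4`).

Contents: Part A — elementary inequalities (`(1 − 1/r)^{6r} ≤ e^{−6}`, `(1 + 1/(r−1))^{6r} ≤ e^{12}`, the
eventual conditions on `ℓ = log N`, `eventually_conditions`); Part B — the two bounds for
`G = ∑_{|μ| ≤ M} min(2M+1, 1/(2‖αμ‖))`; Part C — `U_bound_of_instance` (hypothesis: the one instance `ρ = 6n`,
`k = 7n²` of the mean value theorem that is used) and `U_bound` (hypothesis: the mean value theorem in the shape of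
Ivić's Lemma 6.3 with constant `A`, i.e. `VMVTBound A`).

## References
* A. Ivić, *The Riemann Zeta-Function*, John Wiley & Sons 1985 (Dover 2003), §6.3, proof of Theorem 6.2,
  pp. 122–124, (6.41)–(6.46). [cite: Ivic1985, Theorem 6.2 (proof)]
-/

noncomputable section

open Finset Real Filter

namespace Literature.NumberTheory.LFunctions
namespace VinogradovZetaSum

open VdC (e)
open Sieve.Vinogradov (geomBound geomBound_nonneg geomBound_le geomBound_neg distInt)

/-! ## Part A: elementary inequalities -/

/-- `(1 − 1/r)^{Rr} ≤ e^{−R}` (`r ≥ 1`). [folklore] -/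
theorem one_sub_inv_pow_mul_le (R : ℕ) {r : ℕ} (hr : 1 ≤ r) :
    (1 - 1 / (r : ℝ)) ^ (R * r) ≤ Real.exp (-(R : ℝ)) := by
  have hr0 : (0 : ℝ) < r := by exact_mod_cast hr
  have h1 : (1 - 1 / (r : ℝ)) ^ r ≤ Real.exp (-1) := Real.one_sub_div_pow_le_exp_neg (by exact_mod_cast hr)
  have h0 : 0 ≤ 1 - 1 / (r : ℝ) := by
    rw [sub_nonneg, div_le_one hr0]; exact_mod_cast hr
  calc (1 - 1 / (r : ℝ)) ^ (R * r) = ((1 - 1 / (r : ℝ)) ^ r) ^ R := by rw [mul_comm, pow_mul]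
    _ ≤ (Real.exp (-1)) ^ R := pow_le_pow_left₀ (pow_nonneg h0 _) h1 R
    _ = Real.exp (-(R : ℝ)) := by rw [← Real.exp_nat_mul]; congr 1; ring

/-- `(1 + 1/(r−1))^{Rr} ≤ e^{2R}` (`r ≥ 2`). [folklore] -/
theorem one_add_inv_pow_mul_le (R : ℕ) {r : ℕ} (hr : 2 ≤ r) :
    (1 + 1 / ((r : ℝ) - 1)) ^ (R * r) ≤ Real.exp (2 * R) := by
  have hr2 : (2 : ℝ) ≤ r := by exact_mod_cast hr
  have hpos : 0 < (r : ℝ) - 1 := by linarith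
  have h1 : 1 + 1 / ((r : ℝ) - 1) ≤ Real.exp (1 / ((r : ℝ) - 1)) := by
    have := Real.add_one_le_exp (1 / ((r : ℝ) - 1)); linarith
  have h0 : 0 ≤ 1 + 1 / ((r : ℝ) - 1) := by positivity
  calc (1 + 1 / ((r : ℝ) - 1)) ^ (R * r) ≤ (Real.exp (1 / ((r : ℝ) - 1))) ^ (R * r) :=
        pow_le_pow_left₀ h0 h1 _
    _ = Real.exp ((R * r : ℕ) * (1 / ((r : ℝ) - 1))) := by rw [← Real.exp_nat_mul]
    _ ≤ Real.exp (2 * R) := by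
        rw [Real.exp_le_exp]
        push_cast
        rw [mul_one_div, div_le_iff₀ hpos]
        nlinarith [(Nat.cast_nonneg R : (0 : ℝ) ≤ R)]

/-- `e⁶ ≥ 403`, so `e^{−6} ≤ 1/403`. [folklore] -/
theorem exp_neg_six_le : Real.exp (-(6 : ℝ)) ≤ 1 / 403 := by
  have h := Real.exp_one_gt_d9
  have h6 : (403 : ℝ) ≤ Real.exp 6 := by
    have : Real.exp 6 = (Real.exp 1) ^ 6 := by rw [← Real.exp_nat_mul]; norm_num
    rw [this]
    have h2 : (2.7182818283 : ℝ) ^ 6 ≤ (Real.exp 1) ^ 6 := pow_le_pow_left₀ (by norm_num) h.le 6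
    refine le_trans (by norm_num) h2
  rw [Real.exp_neg, one_div]
  exact inv_anti₀ (by norm_num) h6

/-- `∑_{i<r} (i+1) = r(r+1)/2` over `Fin r`, as reals. [folklore] -/
theorem sum_fin_val_add_one (r : ℕ) : ∑ j : Fin r, ((j.val : ℝ) + 1) = (r : ℝ) * (r + 1) / 2 := by
  rw [Fin.sum_univ_eq_sum_range (fun i => (i : ℝ) + 1)]
  induction r with
  | zero => simp
  | succ r ih => rw [sum_range_succ, ih]; push_cast; ring

/-- `log x ≤ ε x` eventually, for every `ε > 0`. [folklore] -/
theorem eventually_log_le_mul {ε : ℝ} (hε : 0 < ε) : ∀ᶠ x : ℝ in atTop, Real.log x ≤ ε * x := by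
  have h := Real.tendsto_pow_log_div_mul_add_atTop 1 0 1 one_ne_zero
  have h2 : ∀ᶠ x : ℝ in atTop, Real.log x ^ 1 / (1 * x + 0) ≤ ε := h.eventually (eventually_le_nhds hε)
  filter_upwards [h2, eventually_gt_atTop (0 : ℝ)] with x hx hx0
  rw [pow_one, one_mul, add_zero, div_le_iff₀ hx0] at hx
  exact hx

/-- `√ℓ log(c√ℓ) ≤ ε ℓ` eventually (`c, ε > 0`). [folklore] -/
theorem eventually_sqrt_mul_log_le {c ε : ℝ} (hc : 0 < c) (hε : 0 < ε) :
    ∀ᶠ ℓ : ℝ in atTop, Real.sqrt ℓ * Real.log (c * Real.sqrt ℓ) ≤ ε * ℓ := by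
  have h1 := eventually_log_le_mul (ε := ε / c) (by positivity)
  have h2 : Tendsto (fun ℓ : ℝ => c * Real.sqrt ℓ) atTop atTop :=
    (Real.tendsto_sqrt_atTop).const_mul_atTop hc
  filter_upwards [h2.eventually h1, eventually_ge_atTop (0 : ℝ)] with ℓ hℓ hℓ0
  have hs : Real.sqrt ℓ * Real.sqrt ℓ = ℓ := Real.mul_self_sqrt hℓ0
  calc Real.sqrt ℓ * Real.log (c * Real.sqrt ℓ) ≤ Real.sqrt ℓ * (ε / c * (c * Real.sqrt ℓ)) :=
        mul_le_mul_of_nonneg_left hℓ (Real.sqrt_nonneg ℓ)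
    _ = ε * (Real.sqrt ℓ * Real.sqrt ℓ) * (c / c) := by ring
    _ = ε * ℓ := by rw [hs, div_self hc.ne', mul_one]

/-- **The conditions on `ℓ = log N`** under which `U_bound` holds, all true for `ℓ ≥ ℓ₀(A)`. [folklore] -/
theorem eventually_conditions {A : ℝ} (hA : 1 ≤ A) : ∀ᶠ ℓ : ℝ in atTop,
    2300 ≤ ℓ ∧ Real.log ℓ + 34 ≤ ℓ / 11 ∧
      11475 * A * (Real.sqrt ℓ * Real.log (5.15 * A * Real.sqrt ℓ)) ≤ ℓ / 100 ∧
      1030 * Real.log (557 * ℓ) ≤ 10.5 * ℓ ∧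
      A * Real.exp 12 * 5.15 * (Real.sqrt ℓ * Real.log (5.15 * A * Real.sqrt ℓ)) ≤ 0.4 * ℓ - 1 ∧
      557 * ℓ ≤ Real.exp (8.4 * ℓ) := by
  have hA0 : 0 < A := by linarith
  have hc : 0 < 5.15 * A := by positivity
  have e1 := eventually_log_le_mul (ε := 1 / 200) (by norm_num)
  have e2 := eventually_sqrt_mul_log_le hc (ε := 1 / (100 * (11475 * A))) (by positivity)
  have e3 := eventually_sqrt_mul_log_le hc (ε := 0.2 / (A * Real.exp 12 * 5.15)) (by positivity)
  filter_upwards [eventually_ge_atTop (2300 : ℝ), e1, e2, e3] with ℓ h1 h2 h3 h4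
  have hℓ0 : 0 < ℓ := by linarith
  refine ⟨h1, ?_, ?_, ?_, ?_, ?_⟩
  · -- `log ℓ ≤ ℓ/200` and `34 ≤ ℓ/11 - ℓ/200`
    linarith
  · calc 11475 * A * (Real.sqrt ℓ * Real.log (5.15 * A * Real.sqrt ℓ))
        ≤ 11475 * A * (1 / (100 * (11475 * A)) * ℓ) := mul_le_mul_of_nonneg_left h3 (by positivity)
      _ = ℓ / 100 := by field_simp
  · -- `log(557 ℓ) = log 557 + log ℓ ≤ 7 + ℓ/200`
    rw [Real.log_mul (by norm_num) hℓ0.ne']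
    have h557 : Real.log 557 ≤ 7 := by
      rw [Real.log_le_iff_le_exp (by norm_num)]
      have h := Real.exp_one_gt_d9
      have : Real.exp 7 = (Real.exp 1) ^ 7 := by rw [← Real.exp_nat_mul]; norm_num
      rw [this]
      have h2 : (2.7182818283 : ℝ) ^ 7 ≤ (Real.exp 1) ^ 7 := pow_le_pow_left₀ (by norm_num) h.le 7
      exact le_trans (by norm_num) h2
    linarith
  · calc A * Real.exp 12 * 5.15 * (Real.sqrt ℓ * Real.log (5.15 * A * Real.sqrt ℓ))
        ≤ A * Real.exp 12 * 5.15 * (0.2 / (A * Real.exp 12 * 5.15) * ℓ) :=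
          mul_le_mul_of_nonneg_left h4 (by positivity)
      _ = 0.2 * ℓ := by field_simp
      _ ≤ 0.4 * ℓ - 1 := by linarith
  · have hq := Real.quadratic_le_exp_of_nonneg (show 0 ≤ 8.4 * ℓ by positivity)
    nlinarith

/-! ## Part B: the two bounds for `G = ∑_{|μ| ≤ M} min(2M+1, 1/(2‖αμ‖))` -/

/-- **Trivial bound**: `∑_{|μ| ≤ M} min(2M+1, 1/(2‖xμ‖)) ≤ (2M+1)²`. [cite: Ivic1985, Theorem 6.2 (proof)] -/
theorem sum_geomBound_Icc_le_sq (x : ℝ) (M : ℕ) :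
    ∑ μ ∈ Finset.Icc (-(M : ℤ)) M, geomBound (2 * M + 1) (x * μ) ≤ (2 * M + 1) ^ 2 := by
  calc ∑ μ ∈ Finset.Icc (-(M : ℤ)) M, geomBound (2 * M + 1) (x * μ)
      ≤ ∑ _μ ∈ Finset.Icc (-(M : ℤ)) M, ((2 * M + 1 : ℝ)) := sum_le_sum fun μ _ => geomBound_le _ _
    _ = (2 * M + 1) ^ 2 := by
        rw [sum_const, nsmul_eq_mul, Int.card_Icc]
        have : ((M : ℤ) + 1 - -(M : ℤ)).toNat = 2 * M + 1 := by omega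
        rw [this]; push_cast; ring

/-- **The bound on a good index** (Ivić p. 122–123): if `Q ≥ 2`, `2M + 1 ≤ ⌊Q⌋` and `s = ±1`, then
`∑_{|μ| ≤ M} min(2M+1, 1/(2‖(s/Q)μ‖)) ≤ 24 Q (1 + log(Q+1))` (Lemma 6.5 with `α = s/Q = s/q + θ/q²`,
`q = ⌊Q⌋`). [cite: Ivic1985, Theorem 6.2 (proof)] -/
theorem sum_geomBound_Icc_le_of_good {Q : ℝ} (hQ : 2 ≤ Q) {M : ℕ} (hM : (2 * M + 1 : ℝ) ≤ ⌊Q⌋₊) {s : ℤ}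
    (hs : s = 1 ∨ s = -1) :
    ∑ μ ∈ Finset.Icc (-(M : ℤ)) M, geomBound (2 * M + 1) ((s : ℝ) / Q * μ) ≤ 24 * Q * (1 + Real.log (Q + 1)) := by
  set q : ℕ := ⌊Q⌋₊ with hq
  have hQ0 : 0 < Q := by linarith
  have hqQ : (q : ℝ) ≤ Q := Nat.floor_le hQ0.le
  have hq2 : 2 ≤ q := by rw [hq]; exact Nat.le_floor (by exact_mod_cast hQ)
  have hq0 : 0 < q := by omega
  have hq0' : (0 : ℝ) < q := by exact_mod_cast hq0
  have hQq : Q < q + 1 := by rw [hq]; exact Nat.lt_floor_add_one Q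
  -- the rational approximation
  have hcop : IsCoprime s (q : ℤ) := by
    rcases hs with h | h <;> rw [h]
    · exact isCoprime_one_left
    · exact (isCoprime_one_left).neg_left
  have hs1 : |(s : ℝ)| = 1 := by rcases hs with h | h <;> simp [h]
  have happrox : |(s : ℝ) / Q - s / q| ≤ 1 / (q : ℝ) ^ 2 := by
    have h1 : (s : ℝ) / Q - s / q = s * (1 / Q - 1 / q) := by ring
    rw [h1, abs_mul, hs1, one_mul]
    have h2 : 1 / Q - 1 / (q : ℝ) ≤ 0 := by rw [sub_nonpos]; exact one_div_le_one_div_of_le hq0' hqQ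
    rw [abs_of_nonpos h2, neg_sub, div_sub_div _ _ hq0'.ne' hQ0.ne', div_le_div_iff₀ (by positivity) (by positivity)]
    have hQq1 : Q - q ≤ 1 := by linarith
    have h3 : (Q - q) * (q : ℝ) ^ 2 ≤ 1 * (q : ℝ) ^ 2 := mul_le_mul_of_nonneg_right hQq1 (sq_nonneg _)
    have h4 : (q : ℝ) * q ≤ q * Q := mul_le_mul_of_nonneg_left hqQ hq0'.le
    nlinarith [h3, h4]
  have h65 := sum_geomBound_linear_Icc_le (α := (s : ℝ) / Q) (U := 2 * M + 1) (by positivity) hq0 hcop happrox M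
  refine h65.trans ?_
  have hlog0 : 0 ≤ Real.log (q + 1) := Real.log_nonneg (by linarith)
  have hlogQ : Real.log ((q : ℝ) + 1) ≤ Real.log (Q + 1) := Real.log_le_log (by positivity) (by linarith)
  have hlogQ0 : 0 ≤ Real.log (Q + 1) := Real.log_nonneg (by linarith)
  have h1 : (2 * (M : ℝ) + 1) / q + 1 ≤ 2 := by
    rw [div_add_one hq0'.ne', div_le_iff₀ hq0']; linarith
  have h2 : 6 * (2 * (M : ℝ) + 1) + 6 * q * (1 + Real.log (q + 1)) ≤ 12 * Q * (1 + Real.log (Q + 1)) := by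
    have : 6 * (q : ℝ) * (1 + Real.log (q + 1)) ≤ 6 * Q * (1 + Real.log (Q + 1)) := by gcongr
    nlinarith
  calc ((2 * (M : ℝ) + 1) / q + 1) * (6 * (2 * (M : ℝ) + 1) + 6 * q * (1 + Real.log (q + 1)))
      ≤ 2 * (12 * Q * (1 + Real.log (Q + 1))) := by
        apply mul_le_mul h1 h2 (by positivity) (by norm_num)
    _ = 24 * Q * (1 + Real.log (Q + 1)) := by ring

/-- The trivial bound in the indexing of `core_bound` (`M = k a^m`). [cite: Ivic1985, Theorem 6.2 (proof)] -/
theorem sum_geomBound_le_sq (k a m : ℕ) (x : ℝ) :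
    ∑ μ ∈ Finset.Icc (-((k : ℤ) * (a : ℤ) ^ m)) ((k : ℤ) * (a : ℤ) ^ m), geomBound (2 * k * (a : ℝ) ^ m + 1) (x * μ) ≤
      (2 * k * (a : ℝ) ^ m + 1) ^ 2 := by
  have h := sum_geomBound_Icc_le_sq x (k * a ^ m)
  have h1 : ((k * a ^ m : ℕ) : ℤ) = (k : ℤ) * (a : ℤ) ^ m := by push_cast; ring
  have h2 : (2 * ((k * a ^ m : ℕ) : ℝ) + 1) = 2 * k * (a : ℝ) ^ m + 1 := by push_cast; ring
  rwa [h1, h2] at h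

/-- The good-index bound in the indexing of `core_bound`. [cite: Ivic1985, Theorem 6.2 (proof)] -/
theorem sum_geomBound_le_of_good (k a m : ℕ) {Q : ℝ} (hQ : 2 ≤ Q) (hM : 2 * k * (a : ℝ) ^ m + 1 ≤ ⌊Q⌋₊)
    {s : ℤ} (hs : s = 1 ∨ s = -1) :
    ∑ μ ∈ Finset.Icc (-((k : ℤ) * (a : ℤ) ^ m)) ((k : ℤ) * (a : ℤ) ^ m), geomBound (2 * k * (a : ℝ) ^ m + 1) ((s : ℝ) / Q * μ) ≤
      24 * Q * (1 + Real.log (Q + 1)) := by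
  have h1 : ((k * a ^ m : ℕ) : ℤ) = (k : ℤ) * (a : ℤ) ^ m := by push_cast; ring
  have h2 : (2 * ((k * a ^ m : ℕ) : ℝ) + 1) = 2 * k * (a : ℝ) ^ m + 1 := by push_cast; ring
  have h := sum_geomBound_Icc_le_of_good hQ (M := k * a ^ m) (by rw [h2]; exact hM) hs
  rwa [h1, h2] at h

/-! ## Part C: the bound for `U(n)` -/

/-- `log x ≤ x - 1` packaged for numerals: `log 2 ≤ 1`, `log 3 ≤ 2`, `log 6 ≤ 5`, `log 24 ≤ 23`. [folklore] -/
theorem log_le_pred {x : ℝ} (hx : 0 < x) : Real.log x ≤ x - 1 := Real.log_le_sub_one_of_pos hx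

/-- `e^{-1} ≤ 1/2`. [folklore] -/
theorem exp_neg_one_le_half : Real.exp (-1) ≤ 1 / 2 := by
  have h := Real.exp_one_gt_d9
  rw [Real.exp_neg]
  rw [inv_le_comm₀ (Real.exp_pos 1) (by norm_num)]
  linarith

set_option maxHeartbeats 2000000 in
/-- **The estimate at a good index** `m = i + 1 ∈ (3Y, 4Y]` (Ivić pp. 122–123, with crude constants):
with `ℓ = log N ≥ 2300`, `t = N^Y ≥ 1`, `Y ≥ 10.5`, `N < n ≤ 2N`, `0 < u ≤ 1`, `e^{0.4ℓ}/2 ≤ a ≤ e^{0.4ℓ}`, `1 ≤ k`,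
`3k ≤ 557ℓ ≤ e^{8.4ℓ}` and `log ℓ + 34 ≤ ℓ/11`:
`log ∑_{|μ| ≤ ka^m} min(2ka^m+1, 1/(2‖α_m μ‖)) ≤ 2 log(2ka^m + 1) − 0.18 Y ℓ`, `α_m = (−1)^m t/(2πm(n+u)^m)`
(the trivial bound being `2 log(2ka^m+1)`: the saving `N^{m/5}/t ≤ N^{−Y/5}` of Lemma 6.5 beats the losses
`O(m + log ℓ)`). [cite: Ivic1985, Theorem 6.2 (proof)] -/
theorem log_sum_geomBound_good_le {N n a k i : ℕ} {t u ℓ Y : ℝ}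
    (hℓ : Real.log N = ℓ) (hYℓt : Y * ℓ = Real.log t) (ht1 : 1 ≤ t) (hN0 : 0 < N) (hNn : N < n)
    (hn2 : n ≤ 2 * N) (hu0 : 0 < u) (hu1 : u ≤ 1) (hY : 10.5 ≤ Y) (c1 : 2300 ≤ ℓ)
    (c2 : Real.log ℓ + 34 ≤ ℓ / 11) (c6 : 557 * ℓ ≤ Real.exp (8.4 * ℓ))
    (ha_half : Real.exp (0.4 * ℓ) / 2 ≤ a) (hax : (a : ℝ) ≤ Real.exp (0.4 * ℓ))
    (hk1 : 1 ≤ k) (hk : 3 * (k : ℝ) ≤ 557 * ℓ) (hi1 : 3 * Y < (i : ℝ) + 1) (hi2 : (i : ℝ) + 1 ≤ 4 * Y) :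
    Real.log (∑ μ ∈ Finset.Icc (-((k : ℤ) * (a : ℤ) ^ (i + 1))) ((k : ℤ) * (a : ℤ) ^ (i + 1)),
        geomBound (2 * k * (a : ℝ) ^ (i + 1) + 1)
          (((-1) ^ (i + 1) * t / (2 * π * ((i : ℝ) + 1) * ((n : ℝ) + u) ^ (i + 1))) * μ)) ≤
      2 * Real.log (2 * k * (a : ℝ) ^ (i + 1) + 1) - 0.18 * Y * ℓ := by
  -- basic positivity
  have hm0 : (0 : ℝ) ≤ i := Nat.cast_nonneg i
  have hm1 : (1 : ℝ) ≤ (i : ℝ) + 1 := by linarith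
  have hℓ0 : 0 < ℓ := by linarith
  have hY0 : 0 < Y := by linarith
  have hN0' : (0 : ℝ) < N := by exact_mod_cast hN0
  have h1N : (1 : ℝ) ≤ N := by exact_mod_cast hN0
  have hNexp : (N : ℝ) = Real.exp ℓ := by rw [← hℓ, Real.exp_log hN0']
  have ht0 : 0 < t := by linarith
  have htexp : t = Real.exp (Y * ℓ) := by rw [hYℓt, Real.exp_log ht0]
  have hk1' : (1 : ℝ) ≤ k := by exact_mod_cast hk1
  have hπ3 : 3 < π := Real.pi_gt_three
  have hπ4 : π < 3.15 := Real.pi_lt_d2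
  -- `a ≥ e^{0.4ℓ - 1} ≥ 1`
  have ha_low : Real.exp (0.4 * ℓ - 1) ≤ a := by
    calc Real.exp (0.4 * ℓ - 1) = Real.exp (0.4 * ℓ) * Real.exp (-1) := by rw [← Real.exp_add]; ring_nf
      _ ≤ Real.exp (0.4 * ℓ) * (1 / 2) := by gcongr; exact exp_neg_one_le_half
      _ = Real.exp (0.4 * ℓ) / 2 := by ring
      _ ≤ a := ha_half
  have ha1 : (1 : ℝ) ≤ a := le_trans (Real.one_le_exp (by linarith)) ha_low
  have ha0 : (0 : ℝ) < a := by linarith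
  -- `w = n + u ∈ [N, 3N]`
  set w : ℝ := (n : ℝ) + u with hw
  have hNw : (N : ℝ) ≤ w := by
    have : (N : ℝ) + 1 ≤ n := by exact_mod_cast hNn
    rw [hw]; linarith
  have hw0 : 0 < w := by linarith
  have hw3 : w ≤ 3 * N := by
    have : (n : ℝ) ≤ 2 * N := by exact_mod_cast hn2
    rw [hw]; linarith
  -- `Q = 2π m w^m / t` and the coefficient `α_m = (−1)^m / Q`
  set Q : ℝ := 2 * π * ((i : ℝ) + 1) * w ^ (i + 1) / t with hQ
  have hQ0 : 0 < Q := by positivity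
  have hcoef : (-1 : ℝ) ^ (i + 1) * t / (2 * π * ((i : ℝ) + 1) * w ^ (i + 1)) =
      (((-1 : ℤ) ^ (i + 1) : ℤ) : ℝ) / Q := by
    rw [hQ]; push_cast
    field_simp
  -- `e^{(m - Y)ℓ} ≤ Q/2`, hence `Q ≥ 2`
  have hwm : Real.exp (((i : ℝ) + 1) * ℓ) ≤ w ^ (i + 1) := by
    calc Real.exp (((i : ℝ) + 1) * ℓ) = (Real.exp ℓ) ^ (i + 1) := by
          rw [← Real.exp_nat_mul]; push_cast; ring_nf
      _ = (N : ℝ) ^ (i + 1) := by rw [hNexp]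
      _ ≤ w ^ (i + 1) := pow_le_pow_left₀ hN0'.le hNw _
  have hQlow : Real.exp (((i : ℝ) + 1 - Y) * ℓ) ≤ Q / 2 := by
    have h1 : Real.exp (((i : ℝ) + 1 - Y) * ℓ) = Real.exp (((i : ℝ) + 1) * ℓ) / t := by
      rw [htexp, ← Real.exp_sub]; ring_nf
    rw [h1]
    calc Real.exp (((i : ℝ) + 1) * ℓ) / t ≤ w ^ (i + 1) / t := by gcongr
      _ ≤ (π * ((i : ℝ) + 1)) * (w ^ (i + 1) / t) := by
          refine le_mul_of_one_le_left (by positivity) ?_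
          nlinarith
      _ = Q / 2 := by rw [hQ]; ring
  have hmY : 0 < ((i : ℝ) + 1 - Y) * ℓ := mul_pos (by linarith) hℓ0
  have hQ2 : 2 ≤ Q := by
    have : 1 ≤ Real.exp (((i : ℝ) + 1 - Y) * ℓ) := Real.one_le_exp hmY.le
    linarith
  -- the floor condition `2ka^m + 1 ≤ ⌊Q⌋`
  have ham : (a : ℝ) ^ (i + 1) ≤ Real.exp (0.4 * ((i : ℝ) + 1) * ℓ) := by
    calc (a : ℝ) ^ (i + 1) ≤ (Real.exp (0.4 * ℓ)) ^ (i + 1) := pow_le_pow_left₀ ha0.le hax _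
      _ = Real.exp (0.4 * ((i : ℝ) + 1) * ℓ) := by rw [← Real.exp_nat_mul]; push_cast; ring_nf
  have hkam1 : (1 : ℝ) ≤ k * (a : ℝ) ^ (i + 1) := one_le_mul_of_one_le_of_one_le hk1' (one_le_pow₀ ha1)
  have hfloor : 2 * k * (a : ℝ) ^ (i + 1) + 1 ≤ ⌊Q⌋₊ := by
    have hfl : Q - 1 ≤ ⌊Q⌋₊ := (Nat.sub_one_lt_floor Q).le
    have h3k : 3 * (k : ℝ) ≤ Real.exp ((0.6 * ((i : ℝ) + 1) - Y) * ℓ) := by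
      refine hk.trans (c6.trans ?_)
      rw [Real.exp_le_exp]
      have : 8.4 ≤ 0.6 * ((i : ℝ) + 1) - Y := by linarith
      nlinarith
    calc 2 * k * (a : ℝ) ^ (i + 1) + 1 ≤ 3 * k * (a : ℝ) ^ (i + 1) := by linarith
      _ ≤ Real.exp ((0.6 * ((i : ℝ) + 1) - Y) * ℓ) * Real.exp (0.4 * ((i : ℝ) + 1) * ℓ) :=
          mul_le_mul h3k ham (by positivity) (by positivity)
      _ = Real.exp (((i : ℝ) + 1 - Y) * ℓ) := by rw [← Real.exp_add]; ring_nf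
      _ ≤ Q / 2 := hQlow
      _ ≤ Q - 1 := by linarith
      _ ≤ ⌊Q⌋₊ := hfl
  -- Lemma 6.5 at this index
  have hs : ((-1 : ℤ) ^ (i + 1) = 1 ∨ (-1 : ℤ) ^ (i + 1) = -1) := neg_one_pow_eq_or ℤ (i + 1)
  have hG := sum_geomBound_le_of_good k a (i + 1) hQ2 hfloor hs
  simp_rw [hcoef]
  -- positivity of the sum: the term `μ = 0` equals `L = 2ka^m + 1`
  set L : ℝ := 2 * k * (a : ℝ) ^ (i + 1) + 1 with hL
  have hL1 : 1 ≤ L := by rw [hL]; linarith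
  have hSpos : 0 < ∑ μ ∈ Finset.Icc (-((k : ℤ) * (a : ℤ) ^ (i + 1))) ((k : ℤ) * (a : ℤ) ^ (i + 1)),
      geomBound L ((((-1 : ℤ) ^ (i + 1) : ℤ) : ℝ) / Q * μ) := by
    have hmem : (0 : ℤ) ∈ Finset.Icc (-((k : ℤ) * (a : ℤ) ^ (i + 1))) ((k : ℤ) * (a : ℤ) ^ (i + 1)) := by
      have h1 : (0 : ℤ) ≤ (k : ℤ) * (a : ℤ) ^ (i + 1) :=
        mul_nonneg (Int.natCast_nonneg k) (pow_nonneg (Int.natCast_nonneg a) (i + 1))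
      rw [Finset.mem_Icc]; constructor <;> linarith
    have h0 : geomBound L ((((-1 : ℤ) ^ (i + 1) : ℤ) : ℝ) / Q * ((0 : ℤ) : ℝ)) = L := by
      rw [Int.cast_zero, mul_zero, Sieve.Vinogradov.geomBound_zero]
    have h1 := Finset.single_le_sum (f := fun μ : ℤ => geomBound L ((((-1 : ℤ) ^ (i + 1) : ℤ) : ℝ) / Q * μ))
      (fun μ _ => geomBound_nonneg (by linarith) _) hmem
    rw [h0] at h1
    exact lt_of_lt_of_le (zero_lt_one.trans_le hL1) h1
  -- `log G ≤ log 24 + log Q + log(1 + log(Q+1))`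
  have hlogQ1 : 0 < 1 + Real.log (Q + 1) := by
    have := Real.log_nonneg (by linarith : 1 ≤ Q + 1); linarith
  have hlogG : Real.log (∑ μ ∈ Finset.Icc (-((k : ℤ) * (a : ℤ) ^ (i + 1))) ((k : ℤ) * (a : ℤ) ^ (i + 1)),
      geomBound L ((((-1 : ℤ) ^ (i + 1) : ℤ) : ℝ) / Q * μ)) ≤
      Real.log 24 + Real.log Q + Real.log (1 + Real.log (Q + 1)) := by
    rw [← Real.log_mul (by norm_num) hQ0.ne', ← Real.log_mul (by positivity) hlogQ1.ne']
    exact Real.log_le_log hSpos hG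
  -- `log Q ≤ (2π − 1) + (m − 1) + m(2 + ℓ) − Yℓ`
  have hQup : Q ≤ 2 * π * ((i : ℝ) + 1) * (3 * N) ^ (i + 1) / t := by
    rw [hQ]; gcongr
  have hlogQ : Real.log Q ≤ (2 * π - 1) + (i : ℝ) + ((i : ℝ) + 1) * (2 + ℓ) - Y * ℓ := by
    have h1 : Real.log Q ≤ Real.log (2 * π * ((i : ℝ) + 1) * (3 * N) ^ (i + 1) / t) := Real.log_le_log hQ0 hQup
    have h2 : Real.log (2 * π * ((i : ℝ) + 1) * (3 * N) ^ (i + 1) / t) =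
        Real.log (2 * π) + Real.log ((i : ℝ) + 1) + (i + 1 : ℕ) * (Real.log 3 + ℓ) - Y * ℓ := by
      rw [Real.log_div (by positivity) ht0.ne', Real.log_mul (by positivity) (by positivity),
        Real.log_mul (by positivity) (by positivity), Real.log_pow, Real.log_mul (by norm_num) hN0'.ne', hℓ,
        ← hYℓt]
    have hlog2π : Real.log (2 * π) ≤ 2 * π - 1 := log_le_pred (by positivity)
    have hlogm : Real.log ((i : ℝ) + 1) ≤ (i : ℝ) + 1 - 1 := log_le_pred (by positivity)
    have hlog3 : Real.log 3 ≤ 2 := by have := log_le_pred (show (0 : ℝ) < 3 by norm_num); linarith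
    rw [h2] at h1
    push_cast at h1
    have h3 : ((i : ℝ) + 1) * (Real.log 3 + ℓ) ≤ ((i : ℝ) + 1) * (2 + ℓ) := by gcongr
    linarith
  -- `1 + log(Q+1) ≤ 6 m ℓ`, so `log(1 + log(Q+1)) ≤ 5 + (m − 1) + log ℓ`
  have hlogQp1 : 1 + Real.log (Q + 1) ≤ 6 * ((i : ℝ) + 1) * ℓ := by
    have h1 : Real.log (Q + 1) ≤ Real.log (2 * Q) := Real.log_le_log (by linarith) (by linarith)
    rw [Real.log_mul two_ne_zero hQ0.ne'] at h1
    have hlog2 : Real.log 2 ≤ 1 := by have := log_le_pred (show (0 : ℝ) < 2 by norm_num); linarith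
    have hmℓ : 2300 * ((i : ℝ) + 1) ≤ ((i : ℝ) + 1) * ℓ := by nlinarith
    nlinarith
  have hloglog : Real.log (1 + Real.log (Q + 1)) ≤ 5 + (i : ℝ) + Real.log ℓ := by
    calc Real.log (1 + Real.log (Q + 1)) ≤ Real.log (6 * ((i : ℝ) + 1) * ℓ) := Real.log_le_log hlogQ1 hlogQp1
      _ = Real.log 6 + Real.log ((i : ℝ) + 1) + Real.log ℓ := by
          rw [Real.log_mul (by positivity) hℓ0.ne', Real.log_mul (by norm_num) (by positivity)]
      _ ≤ 5 + (i : ℝ) + Real.log ℓ := by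
          have h6 : Real.log 6 ≤ 5 := by have := log_le_pred (show (0 : ℝ) < 6 by norm_num); linarith
          have hm : Real.log ((i : ℝ) + 1) ≤ (i : ℝ) + 1 - 1 := log_le_pred (by positivity)
          linarith
  -- lower bound `log L ≥ log 2 + m (0.4 ℓ − 1)`
  have hlogL : Real.log 2 + ((i : ℝ) + 1) * (0.4 * ℓ - 1) ≤ Real.log L := by
    have ham_low : Real.exp (((i : ℝ) + 1) * (0.4 * ℓ - 1)) ≤ (a : ℝ) ^ (i + 1) := by
      calc Real.exp (((i : ℝ) + 1) * (0.4 * ℓ - 1)) = (Real.exp (0.4 * ℓ - 1)) ^ (i + 1) := by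
            rw [← Real.exp_nat_mul]; push_cast; ring_nf
        _ ≤ (a : ℝ) ^ (i + 1) := pow_le_pow_left₀ (by positivity) ha_low _
    have h2am : 2 * (a : ℝ) ^ (i + 1) ≤ L := by
      rw [hL]
      have : 0 ≤ (a : ℝ) ^ (i + 1) := by positivity
      nlinarith
    calc Real.log 2 + ((i : ℝ) + 1) * (0.4 * ℓ - 1)
        = Real.log (2 * Real.exp (((i : ℝ) + 1) * (0.4 * ℓ - 1))) := by
          rw [Real.log_mul two_ne_zero (Real.exp_pos _).ne', Real.log_exp]
      _ ≤ Real.log L := Real.log_le_log (by positivity) (le_trans (by linarith) h2am)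
  -- numerics
  have hlog24 : Real.log 24 ≤ 23 := by have := log_le_pred (show (0 : ℝ) < 24 by norm_num); linarith
  have hlog2 : 0 ≤ Real.log 2 := Real.log_nonneg (by norm_num)
  have hmℓ4 : ((i : ℝ) + 1) * ℓ ≤ 4 * Y * ℓ := by nlinarith
  have h24 : 24 * Y ≤ 0.0105 * Y * ℓ := by nlinarith
  have hℓ11 : ℓ / 11 ≤ 0.0087 * Y * ℓ := by
    rw [div_le_iff₀ (by norm_num : (0 : ℝ) < 11)]; nlinarith
  linarith [hlogG, hlogQ, hloglog, hlogL, hlog24, hlog2, hmℓ4, h24, hℓ11, c2, hπ4, hi2, hm0]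

/-- The trivial bound at any index, in logarithmic form. [cite: Ivic1985, Theorem 6.2 (proof)] -/
theorem log_sum_geomBound_le (k a m : ℕ) (x : ℝ)
    (hpos : 0 < ∑ μ ∈ Finset.Icc (-((k : ℤ) * (a : ℤ) ^ m)) ((k : ℤ) * (a : ℤ) ^ m),
      geomBound (2 * k * (a : ℝ) ^ m + 1) (x * μ)) :
    Real.log (∑ μ ∈ Finset.Icc (-((k : ℤ) * (a : ℤ) ^ m)) ((k : ℤ) * (a : ℤ) ^ m),
        geomBound (2 * k * (a : ℝ) ^ m + 1) (x * μ)) ≤ 2 * Real.log (2 * k * (a : ℝ) ^ m + 1) := by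
  rw [← Real.log_rpow (by positivity), Real.rpow_two]
  · exact Real.log_le_log hpos (sum_geomBound_le_sq k a m x)

set_option maxHeartbeats 4000000 in
/-- **The Vinogradov–Korobov bound for `U(n)` from ONE instance of the mean value theorem** — the form of
`U_bound` whose hypothesis `hV` is only the instance `ρ = 6n`, `k = 7n²` of Vinogradov's mean value theorem that the
proof uses: `J_{7n²,n}([1,P]) ≤ (An)^{42An³} P^{14n² − ½(n²+n)(1 − (1−1/n)^{6n})}` for `n ≥ 2` and
`P ≥ (An)^{An(1+1/(n−1))^{6n}}` (any proof of the mean value theorem — Ivić's Lemma 6.3, Ford's Theorem 3, efficient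
congruencing — supplies it).  See `U_bound` for the statement and the proof sketch.
[cite: Ivic1985, Theorem 6.2 (proof), (6.41)–(6.46)] -/
theorem U_bound_of_instance {A : ℝ} (hA : 1 ≤ A)
    (hV : ∀ (n P : ℕ), 2 ≤ n → (A * n) ^ (A * n * (1 + 1 / ((n : ℝ) - 1)) ^ (6 * n)) ≤ (P : ℝ) →
      (VMV.J n (7 * n ^ 2) (Finset.Icc (1 : ℤ) P) : ℝ) ≤
        (A * n) ^ (A * ((7 * n ^ 2 : ℕ) : ℝ) * ((6 * n : ℕ) : ℝ)) *
          (P : ℝ) ^ (2 * ((7 * n ^ 2 : ℕ) : ℝ) - ((n : ℝ) ^ 2 + n) / 2 * (1 - (1 - 1 / (n : ℝ)) ^ (6 * n))))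
    {N n r a : ℕ} {t u ℓ Y : ℝ}
    (hℓ : Real.log N = ℓ) (hYℓt : Y * ℓ = Real.log t) (ht1 : 1 ≤ t)
    (hNn : N < n) (hn2 : n ≤ 2 * N) (hu0 : 0 < u) (hu1 : u ≤ 1)
    (hY : 10.5 ≤ Y) (hY2 : Y ^ 2 ≤ ℓ)
    (hr : r = ⌊5.05 * Y⌋₊ + 1) (ha : a = ⌊(N : ℝ) ^ (2 / 5 : ℝ)⌋₊)
    (c1 : 2300 ≤ ℓ) (c2 : Real.log ℓ + 34 ≤ ℓ / 11)
    (c3 : 11475 * A * (Real.sqrt ℓ * Real.log (5.15 * A * Real.sqrt ℓ)) ≤ ℓ / 100)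
    (c4 : 1030 * Real.log (557 * ℓ) ≤ 10.5 * ℓ)
    (c5 : A * Real.exp 12 * 5.15 * (Real.sqrt ℓ * Real.log (5.15 * A * Real.sqrt ℓ)) ≤ 0.4 * ℓ - 1)
    (c6 : 557 * ℓ ≤ Real.exp (8.4 * ℓ)) :
    ‖∑ x ∈ Finset.Icc (1 : ℤ) a, ∑ y ∈ Finset.Icc (1 : ℤ) a,
        e (∑ j : Fin r, ((-1) ^ (j.val + 1) * t / (2 * π * ((j.val : ℝ) + 1) * ((n : ℝ) + u) ^ (j.val + 1))) *
          ((x : ℝ) ^ (j.val + 1) * (y : ℝ) ^ (j.val + 1)))‖ ≤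
      (a : ℝ) ^ 2 * Real.exp (-(ℓ / (2000000 * Y ^ 2))) := by
  -- ### basic facts on `N`, `ℓ`, `t`
  have hA0 : 0 < A := by linarith
  have hℓ0 : 0 < ℓ := by linarith
  have hY0 : 0 < Y := by linarith
  have hN0 : 0 < N := by
    rcases Nat.eq_zero_or_pos N with h | h
    · rw [h] at hℓ; simp at hℓ; linarith
    · exact h
  have hN0' : (0 : ℝ) < N := by exact_mod_cast hN0
  have hNexp : (N : ℝ) = Real.exp ℓ := by rw [← hℓ, Real.exp_log hN0']
  have ht0 : 0 < t := by linarith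
  have hYsq : Y ≤ Real.sqrt ℓ := by
    rw [← Real.sqrt_sq hY0.le]; exact Real.sqrt_le_sqrt hY2
  have hsqrt0 : 0 < Real.sqrt ℓ := Real.sqrt_pos.2 hℓ0
  -- ### `a = ⌊N^{2/5}⌋`
  have hxexp : (N : ℝ) ^ (2 / 5 : ℝ) = Real.exp (0.4 * ℓ) := by
    rw [hNexp, ← Real.exp_mul]; ring_nf
  have hax : (a : ℝ) ≤ Real.exp (0.4 * ℓ) := by rw [ha, ← hxexp]; exact Nat.floor_le (by positivity)
  have hx2 : 2 ≤ Real.exp (0.4 * ℓ) := by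
    have := Real.add_one_le_exp (0.4 * ℓ); linarith
  have ha_half : Real.exp (0.4 * ℓ) / 2 ≤ a := by
    have : Real.exp (0.4 * ℓ) - 1 ≤ a := by
      rw [ha, ← hxexp]; exact (Nat.sub_one_lt_floor _).le
    linarith
  have ha1r : (1 : ℝ) ≤ a := by linarith
  have ha1 : 1 ≤ a := by exact_mod_cast ha1r
  have ha0 : (0 : ℝ) < a := by linarith
  have hloga_le : Real.log a ≤ 0.4 * ℓ := by
    rw [← Real.log_exp (0.4 * ℓ)]; exact Real.log_le_log ha0 hax
  have hloga0 : 0 ≤ Real.log a := Real.log_nonneg ha1r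
  have hloga_ge : 0.4 * ℓ - 1 ≤ Real.log a := by
    have h1 : Real.exp (0.4 * ℓ - 1) ≤ a := by
      calc Real.exp (0.4 * ℓ - 1) = Real.exp (0.4 * ℓ) * Real.exp (-1) := by rw [← Real.exp_add]; ring_nf
        _ ≤ Real.exp (0.4 * ℓ) * (1 / 2) := by gcongr; exact exp_neg_one_le_half
        _ ≤ a := by linarith
    rw [← Real.log_exp (0.4 * ℓ - 1)]; exact Real.log_le_log (Real.exp_pos _) h1
  -- ### `r = ⌊5.05Y⌋ + 1`
  have hr_gt : 5.05 * Y < r := by rw [hr]; push_cast; exact Nat.lt_floor_add_one _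
  have hr_le : (r : ℝ) ≤ 5.05 * Y + 1 := by
    rw [hr]; push_cast; linarith [Nat.floor_le (show 0 ≤ 5.05 * Y by positivity)]
  have hr_le' : (r : ℝ) ≤ 5.15 * Y := by linarith
  have hr54 : 54 ≤ r := by
    have : (53 : ℝ) < r := by linarith
    exact_mod_cast this
  have hr2 : 2 ≤ r := by omega
  have hr1 : 1 ≤ r := by omega
  have hr0 : (0 : ℝ) < r := by exact_mod_cast (by omega : 0 < r)
  have hr1' : (1 : ℝ) ≤ r := by exact_mod_cast hr1
  have hr_sqrt : (r : ℝ) ≤ 5.15 * Real.sqrt ℓ := by linarith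
  have hr2Y : (r : ℝ) ^ 2 ≤ 26.5225 * Y ^ 2 := by
    calc (r : ℝ) ^ 2 ≤ (5.15 * Y) ^ 2 := pow_le_pow_left₀ hr0.le hr_le' 2
      _ = 26.5225 * Y ^ 2 := by ring
  -- ### `k = 7r²`
  set k : ℕ := 7 * r ^ 2 with hk
  have hkr : (k : ℝ) = 7 * (r : ℝ) ^ 2 := by rw [hk]; push_cast; ring
  have hk1 : 1 ≤ k := by rw [hk]; have := Nat.one_le_pow 2 r (by omega); omega
  have hk1' : (1 : ℝ) ≤ k := by exact_mod_cast hk1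
  have hk0 : (0 : ℝ) < k := by linarith
  have h3k : 3 * (k : ℝ) ≤ 557 * ℓ := by rw [hkr]; linarith
  have h4k2 : 4 * (k : ℝ) ^ 2 ≤ 137900 * Y ^ 4 := by
    rw [hkr]
    have h1 : (r : ℝ) ^ 4 ≤ (5.15 * Y) ^ 4 := pow_le_pow_left₀ hr0.le hr_le' 4
    have h2 : 0 ≤ Y ^ 4 := by positivity
    calc 4 * (7 * (r : ℝ) ^ 2) ^ 2 = 196 * (r : ℝ) ^ 4 := by ring
      _ ≤ 196 * (5.15 * Y) ^ 4 := by linarith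
      _ ≤ 137900 * Y ^ 4 := by ring_nf; ring_nf at h2; linarith
  -- ### the core bound
  have hcore := core_bound (r := r)
    (fun j : Fin r => (-1) ^ (j.val + 1) * t / (2 * π * ((j.val : ℝ) + 1) * ((n : ℝ) + u) ^ (j.val + 1))) ha1 hk1
  set U : ℝ := ‖∑ x ∈ Finset.Icc (1 : ℤ) a, ∑ y ∈ Finset.Icc (1 : ℤ) a,
      e (∑ j : Fin r, ((-1) ^ (j.val + 1) * t / (2 * π * ((j.val : ℝ) + 1) * ((n : ℝ) + u) ^ (j.val + 1))) *
        ((x : ℝ) ^ (j.val + 1) * (y : ℝ) ^ (j.val + 1)))‖ with hUdef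
  set Jv : ℝ := (VMV.J r k (Finset.Icc (1 : ℤ) a) : ℝ) with hJv
  set G : ℕ → ℝ := fun i => ∑ μ ∈ Finset.Icc (-((k : ℤ) * (a : ℤ) ^ (i + 1))) ((k : ℤ) * (a : ℤ) ^ (i + 1)),
      geomBound (2 * k * (a : ℝ) ^ (i + 1) + 1)
        (((-1) ^ (i + 1) * t / (2 * π * ((i : ℝ) + 1) * ((n : ℝ) + u) ^ (i + 1))) * μ) with hGdef
  have hcore' : U ^ (4 * k ^ 2) ≤ (a : ℝ) ^ (8 * k ^ 2 - 4 * k) * Jv ^ 2 * ∏ i ∈ range r, G i := by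
    rw [← Fin.prod_univ_eq_prod_range (fun i => G i) r]
    exact hcore
  have hU0 : 0 ≤ U := norm_nonneg _
  -- ### the goal is trivial when `U = 0`
  rcases hU0.eq_or_lt with hU00 | hUpos
  · rw [← hU00]; positivity
  -- ### positivity of the factors
  have hG0 : ∀ i, 0 ≤ G i := fun i => sum_nonneg fun μ _ => geomBound_nonneg (by positivity) _
  have hJv0 : 0 ≤ Jv := Nat.cast_nonneg _
  have hRHSpos : 0 < (a : ℝ) ^ (8 * k ^ 2 - 4 * k) * Jv ^ 2 * ∏ i ∈ range r, G i :=
    lt_of_lt_of_le (pow_pos hUpos _) hcore'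
  have hJvpos : 0 < Jv := by
    rcases hJv0.eq_or_lt with h | h
    · rw [← h] at hRHSpos; simp at hRHSpos
    · exact h
  have hPpos : 0 < ∏ i ∈ range r, G i := by
    have h1 : 0 < (a : ℝ) ^ (8 * k ^ 2 - 4 * k) * Jv ^ 2 := by positivity
    exact pos_of_mul_pos_right hRHSpos h1.le
  have hGpos : ∀ i ∈ range r, 0 < G i := by
    intro i hi
    rcases (hG0 i).eq_or_lt with h | h
    · exfalso
      have : ∏ i ∈ range r, G i = 0 := Finset.prod_eq_zero hi h.symm
      rw [this] at hPpos; exact lt_irrefl _ hPpos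
    · exact h
  -- ### taking logarithms
  have hlogU : (4 * (k : ℝ) ^ 2) * Real.log U ≤
      ((8 * (k : ℝ) ^ 2 - 4 * k)) * Real.log a + 2 * Real.log Jv + ∑ i ∈ range r, Real.log (G i) := by
    have h1 := Real.log_le_log (pow_pos hUpos _) hcore'
    rw [Real.log_pow, Real.log_mul (by positivity) hPpos.ne', Real.log_mul (by positivity) (by positivity),
      Real.log_pow, Real.log_pow, Real.log_prod (fun i hi => (hGpos i hi).ne')] at h1
    have hcast : ((8 * k ^ 2 - 4 * k : ℕ) : ℝ) = 8 * (k : ℝ) ^ 2 - 4 * k := by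
      have : 4 * k ≤ 8 * k ^ 2 := by nlinarith
      rw [Nat.cast_sub this]; push_cast; ring
    push_cast at h1
    rw [hcast] at h1
    linarith
  -- ### the mean value theorem: `log Jv ≤ 42 A r³ log(Ar) + (2k − h(1−δ)) log a`
  set δ : ℝ := (1 - 1 / (r : ℝ)) ^ (6 * r) with hδ
  set h : ℝ := ((r : ℝ) ^ 2 + r) / 2 with hh
  have hAr1 : 1 ≤ A * r := one_le_mul_of_one_le_of_one_le hA hr1'
  have hAr0 : 0 < A * r := by linarith
  have hthr : (A * r) ^ (A * r * (1 + 1 / ((r : ℝ) - 1)) ^ (6 * r)) ≤ (a : ℝ) := by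
    have h12 : (1 + 1 / ((r : ℝ) - 1)) ^ (6 * r) ≤ Real.exp 12 := by
      have := one_add_inv_pow_mul_le 6 hr2
      rwa [show (2 : ℝ) * ((6 : ℕ) : ℝ) = 12 by norm_num] at this
    have hE : A * r * (1 + 1 / ((r : ℝ) - 1)) ^ (6 * r) ≤ A * r * Real.exp 12 :=
      mul_le_mul_of_nonneg_left h12 hAr0.le
    have hAr_le : A * r ≤ 5.15 * A * Real.sqrt ℓ := by
      have := mul_le_mul_of_nonneg_left hr_sqrt hA0.le; linarith
    have hlogAr : Real.log (A * r) ≤ Real.log (5.15 * A * Real.sqrt ℓ) := Real.log_le_log hAr0 hAr_le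
    have hlogAr0 : 0 ≤ Real.log (A * r) := Real.log_nonneg hAr1
    calc (A * r) ^ (A * r * (1 + 1 / ((r : ℝ) - 1)) ^ (6 * r))
        ≤ (A * r) ^ (A * r * Real.exp 12) := Real.rpow_le_rpow_of_exponent_le hAr1 hE
      _ = Real.exp (A * r * Real.exp 12 * Real.log (A * r)) := by
          rw [Real.rpow_def_of_pos hAr0]; ring_nf
      _ ≤ Real.exp (0.4 * ℓ - 1) := by
          rw [Real.exp_le_exp]
          calc A * r * Real.exp 12 * Real.log (A * r)
              ≤ A * (5.15 * Real.sqrt ℓ) * Real.exp 12 * Real.log (5.15 * A * Real.sqrt ℓ) := by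
                gcongr
            _ = A * Real.exp 12 * 5.15 * (Real.sqrt ℓ * Real.log (5.15 * A * Real.sqrt ℓ)) := by ring
            _ ≤ 0.4 * ℓ - 1 := c5
      _ ≤ a := by
          calc Real.exp (0.4 * ℓ - 1) = Real.exp (0.4 * ℓ) * Real.exp (-1) := by rw [← Real.exp_add]; ring_nf
            _ ≤ Real.exp (0.4 * ℓ) * (1 / 2) := by gcongr; exact exp_neg_one_le_half
            _ ≤ a := by linarith
  have hJ : Jv ≤ (A * r) ^ (A * k * (6 * r : ℕ)) * (a : ℝ) ^ (2 * (k : ℝ) - ((r : ℝ) ^ 2 + r) / 2 * (1 - δ)) := by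
    have := hV r a hr2 hthr
    rw [hJv]; exact this
  have hlogJ : Real.log Jv ≤ 42 * A * (r : ℝ) ^ 3 * Real.log (A * r) + (2 * k - h * (1 - δ)) * Real.log a := by
    have h1 := Real.log_le_log hJvpos hJ
    rw [Real.log_mul (by positivity) (by positivity), Real.log_rpow hAr0, Real.log_rpow ha0] at h1
    have h2 : A * k * ((6 * r : ℕ) : ℝ) = 42 * A * (r : ℝ) ^ 3 := by push_cast; rw [hkr]; ring
    rw [h2] at h1
    rw [hh]
    linarith
  -- ### the `G`-sum: trivial bound everywhere, the good bound on `⌊Y⌋` indices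
  set M₃ : ℕ := ⌊3 * Y⌋₊ with hM₃
  set M₁ : ℕ := ⌊Y⌋₊ with hM₁
  have hM₃le : (M₃ : ℝ) ≤ 3 * Y := Nat.floor_le (by positivity)
  have hM₁le : (M₁ : ℝ) ≤ Y := Nat.floor_le hY0.le
  have hM₁ge : Y - 1 ≤ M₁ := by rw [hM₁]; linarith [Nat.sub_one_lt_floor Y]
  set good : Finset ℕ := (range r).filter (fun i => M₃ < i + 1 ∧ i + 1 ≤ M₃ + M₁) with hgood
  set bad : Finset ℕ := (range r).filter (fun i => ¬(M₃ < i + 1 ∧ i + 1 ≤ M₃ + M₁)) with hbad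
  have hgood_bound : ∀ i ∈ good, Real.log (G i) ≤ 2 * Real.log (2 * k * (a : ℝ) ^ (i + 1) + 1) - 0.18 * Y * ℓ := by
    intro i hi
    rw [hgood, mem_filter, Finset.mem_range] at hi
    obtain ⟨-, hi1, hi2⟩ := hi
    have hi1' : 3 * Y < (i : ℝ) + 1 := by
      have : (M₃ : ℝ) + 1 ≤ (i : ℝ) + 1 := by exact_mod_cast hi1
      have : 3 * Y < (M₃ : ℝ) + 1 := by rw [hM₃]; exact Nat.lt_floor_add_one _
      linarith
    have hi2' : (i : ℝ) + 1 ≤ 4 * Y := by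
      have : (i : ℝ) + 1 ≤ (M₃ : ℝ) + M₁ := by exact_mod_cast hi2
      linarith
    exact log_sum_geomBound_good_le hℓ hYℓt ht1 hN0 hNn hn2 hu0 hu1 hY c1 c2 c6 ha_half hax hk1 h3k hi1' hi2'
  have htriv_bound : ∀ i ∈ range r, Real.log (G i) ≤ 2 * Real.log (2 * k * (a : ℝ) ^ (i + 1) + 1) := fun i hi =>
    log_sum_geomBound_le k a (i + 1) _ (hGpos i hi)
  -- `2 log(2ka^m + 1) ≤ 2 log(3k) + 2m log a`
  have hL_bound : ∀ i : ℕ, 2 * Real.log (2 * k * (a : ℝ) ^ (i + 1) + 1) ≤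
      2 * Real.log (3 * k) + 2 * ((i : ℝ) + 1) * Real.log a := by
    intro i
    have hkam1 : (1 : ℝ) ≤ k * (a : ℝ) ^ (i + 1) := one_le_mul_of_one_le_of_one_le hk1' (one_le_pow₀ ha1r)
    have h1 : 2 * k * (a : ℝ) ^ (i + 1) + 1 ≤ 3 * k * (a : ℝ) ^ (i + 1) := by linarith
    have h2 : Real.log (2 * k * (a : ℝ) ^ (i + 1) + 1) ≤ Real.log (3 * k * (a : ℝ) ^ (i + 1)) :=
      Real.log_le_log (by positivity) h1
    rw [Real.log_mul (by positivity) (by positivity), Real.log_pow] at h2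
    push_cast at h2
    linarith
  -- the count of good indices
  have hgood_card : (M₁ : ℝ) ≤ good.card := by
    have hsub : Finset.Ico M₃ (M₃ + M₁) ⊆ good := by
      intro i hi
      rw [Finset.mem_Ico] at hi
      rw [hgood, mem_filter, Finset.mem_range]
      refine ⟨?_, by omega, by omega⟩
      have h1 : (i : ℝ) + 1 ≤ (M₃ : ℝ) + M₁ := by exact_mod_cast (show i + 1 ≤ M₃ + M₁ by omega)
      have h2 : (i : ℝ) < r := by linarith
      exact_mod_cast h2
    have := card_le_card hsub
    rw [Nat.card_Ico] at this
    have h' : M₃ + M₁ - M₃ = M₁ := by omega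
    rw [h'] at this
    exact_mod_cast this
  -- splitting the sum over good and bad indices
  have hsumG : ∑ i ∈ range r, Real.log (G i) ≤
      2 * r * Real.log (3 * k) + 2 * h * Real.log a - 0.18 * Y * ℓ * M₁ := by
    have hsplit : ∑ i ∈ range r, Real.log (G i) = ∑ i ∈ good, Real.log (G i) + ∑ i ∈ bad, Real.log (G i) := by
      rw [hgood, hbad]; exact (sum_filter_add_sum_filter_not _ _ _).symm
    have hsplit2 : ∑ i ∈ range r, (2 * Real.log (3 * k) + 2 * ((i : ℝ) + 1) * Real.log a) =
        ∑ i ∈ good, (2 * Real.log (3 * k) + 2 * ((i : ℝ) + 1) * Real.log a) +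
          ∑ i ∈ bad, (2 * Real.log (3 * k) + 2 * ((i : ℝ) + 1) * Real.log a) := by
      rw [hgood, hbad]; exact (sum_filter_add_sum_filter_not _ _ _).symm
    have hgood_sum : ∑ i ∈ good, Real.log (G i) ≤
        ∑ i ∈ good, (2 * Real.log (3 * k) + 2 * ((i : ℝ) + 1) * Real.log a) - 0.18 * Y * ℓ * good.card := by
      calc ∑ i ∈ good, Real.log (G i)
          ≤ ∑ i ∈ good, ((2 * Real.log (3 * k) + 2 * ((i : ℝ) + 1) * Real.log a) - 0.18 * Y * ℓ) :=
            sum_le_sum fun i hi => (hgood_bound i hi).trans (by linarith [hL_bound i])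
        _ = _ := by rw [sum_sub_distrib, sum_const, nsmul_eq_mul]; ring
    have hbad_sum : ∑ i ∈ bad, Real.log (G i) ≤ ∑ i ∈ bad, (2 * Real.log (3 * k) + 2 * ((i : ℝ) + 1) * Real.log a) := by
      refine sum_le_sum fun i hi => ?_
      have hi' : i ∈ range r := by rw [hbad, mem_filter] at hi; exact hi.1
      exact (htriv_bound i hi').trans (hL_bound i)
    have htotal : ∑ i ∈ range r, (2 * Real.log (3 * k) + 2 * ((i : ℝ) + 1) * Real.log a) =
        2 * r * Real.log (3 * k) + 2 * h * Real.log a := by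
      rw [sum_add_distrib, sum_const, Finset.card_range, nsmul_eq_mul, ← sum_mul, ← mul_sum]
      have hgauss : ∑ i ∈ range r, ((i : ℝ) + 1) = h := by
        rw [hh, ← Fin.sum_univ_eq_sum_range (fun i => (i : ℝ) + 1) r, sum_fin_val_add_one]; ring
      rw [hgauss]; ring
    have hneg : -(0.18 * Y * ℓ * good.card) ≤ -(0.18 * Y * ℓ * M₁) := by
      have : 0 ≤ 0.18 * Y * ℓ := by positivity
      nlinarith
    rw [hsplit]
    linarith
  -- ### the budget
  have hδ_le : δ ≤ 1 / 403 := by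
    have h1 : δ ≤ Real.exp (-(6 : ℕ)) := one_sub_inv_pow_mul_le 6 hr1
    refine h1.trans ?_
    norm_num
    exact exp_neg_six_le
  have hδ0 : 0 ≤ δ := by
    rw [hδ]; apply pow_nonneg
    rw [sub_nonneg, div_le_one hr0]; exact hr1'
  have hh_le : h ≤ (r : ℝ) ^ 2 := by rw [hh]; nlinarith
  have hh0 : 0 ≤ h := by rw [hh]; positivity
  -- (T1) `2hδ log a ≤ 0.053 Y² ℓ`
  have hT1 : 2 * h * δ * Real.log a ≤ 0.053 * Y ^ 2 * ℓ := by
    calc 2 * h * δ * Real.log a ≤ 2 * (r : ℝ) ^ 2 * (1 / 403) * (0.4 * ℓ) := by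
          gcongr
      _ ≤ 0.053 * Y ^ 2 * ℓ := by
          have h1 := mul_le_mul_of_nonneg_right hr2Y hℓ0.le
          have h2 : 0 ≤ Y ^ 2 * ℓ := by positivity
          linarith
  -- (T2) `84 A r³ log(Ar) ≤ 0.01 Y² ℓ`
  have hT2 : 84 * A * (r : ℝ) ^ 3 * Real.log (A * r) ≤ 0.01 * Y ^ 2 * ℓ := by
    have hAr_le : A * r ≤ 5.15 * A * Real.sqrt ℓ := by
      have := mul_le_mul_of_nonneg_left hr_sqrt hA0.le; linarith
    have hlogAr : Real.log (A * r) ≤ Real.log (5.15 * A * Real.sqrt ℓ) := Real.log_le_log hAr0 hAr_le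
    have hlogAr0 : 0 ≤ Real.log (A * r) := Real.log_nonneg hAr1
    have hlog0 : 0 ≤ Real.log (5.15 * A * Real.sqrt ℓ) := hlogAr0.trans hlogAr
    have hr3 : (r : ℝ) ^ 3 ≤ (5.15 * Y) ^ 2 * (5.15 * Real.sqrt ℓ) := by
      have : (r : ℝ) ^ 3 = (r : ℝ) ^ 2 * r := by ring
      rw [this]
      exact mul_le_mul (pow_le_pow_left₀ hr0.le hr_le' 2) hr_sqrt hr0.le (by positivity)
    calc 84 * A * (r : ℝ) ^ 3 * Real.log (A * r)
        ≤ 84 * A * ((5.15 * Y) ^ 2 * (5.15 * Real.sqrt ℓ)) * Real.log (5.15 * A * Real.sqrt ℓ) := by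
          gcongr
      _ = (84 * 5.15 ^ 3 / 11475) * Y ^ 2 * (11475 * A * (Real.sqrt ℓ * Real.log (5.15 * A * Real.sqrt ℓ))) := by
          ring
      _ ≤ (84 * 5.15 ^ 3 / 11475) * Y ^ 2 * (ℓ / 100) := by gcongr
      _ ≤ 0.01 * Y ^ 2 * ℓ := by
          have hY2ℓ : 0 ≤ Y ^ 2 * ℓ := by positivity
          linarith [hY2ℓ]
  -- (T3) `2r log(3k) ≤ 0.01 Y² ℓ`
  have hT3 : 2 * r * Real.log (3 * k) ≤ 0.01 * Y ^ 2 * ℓ := by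
    have h3k' : 3 * (k : ℝ) ≤ 557 * ℓ := h3k
    have hlog3k : Real.log (3 * k) ≤ Real.log (557 * ℓ) := Real.log_le_log (by positivity) h3k'
    have hlog3k0 : 0 ≤ Real.log (3 * k) := Real.log_nonneg (by linarith)
    calc 2 * r * Real.log (3 * k) ≤ 2 * (5.15 * Y) * Real.log (557 * ℓ) := by gcongr
      _ = Y / 100 * (1030 * Real.log (557 * ℓ)) := by ring
      _ ≤ Y / 100 * (10.5 * ℓ) := by gcongr
      _ ≤ 0.01 * Y ^ 2 * ℓ := by
          have hYℓ : 0 ≤ Y * ℓ := by positivity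
          have := mul_le_mul_of_nonneg_right hY hYℓ
          linarith
  -- (T4) `−0.18 Y ℓ M₁ ≤ −0.162 Y² ℓ`
  have hT4 : -(0.18 * Y * ℓ * M₁) ≤ -(0.162 * Y ^ 2 * ℓ) := by
    have h09 : 0.9 * Y ≤ M₁ := by linarith
    have := mul_le_mul_of_nonneg_left h09 (show 0 ≤ 0.18 * Y * ℓ by positivity)
    linarith
  -- ### conclusion
  have hbudget : (4 * (k : ℝ) ^ 2) * (Real.log U - 2 * Real.log a) ≤ -(0.089 * Y ^ 2 * ℓ) := by
    have hkk : ((8 * (k : ℝ) ^ 2 - 4 * k)) * Real.log a + 2 * ((2 * k - h * (1 - δ)) * Real.log a) +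
        2 * h * Real.log a = 8 * (k : ℝ) ^ 2 * Real.log a + 2 * h * δ * Real.log a := by ring
    linarith [hlogU, hlogJ, hsumG, hT1, hT2, hT3, hT4, hkk]
  have hfinal : Real.log U - 2 * Real.log a ≤ -(ℓ / (2000000 * Y ^ 2)) := by
    have h4k0 : 0 < 4 * (k : ℝ) ^ 2 := by positivity
    refine le_of_mul_le_mul_left (hbudget.trans ?_) h4k0
    -- `−0.089 Y² ℓ ≤ 4k² · (−ℓ/(2·10⁶ Y²))` since `4k² ≤ 137900 Y⁴`
    rw [mul_neg, neg_le_neg_iff, mul_div_assoc', div_le_iff₀ (by positivity)]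
    have h1 := mul_le_mul_of_nonneg_right h4k2 hℓ0.le
    have h2 : 0 ≤ Y ^ 4 * ℓ := by positivity
    linarith
  have hexp := Real.exp_le_exp.2 hfinal
  rw [Real.exp_sub, Real.exp_log hUpos, show (2 : ℝ) * Real.log a = Real.log a * 2 by ring, Real.exp_mul,
    Real.exp_log ha0, div_le_iff₀ (by positivity)] at hexp
  calc U ≤ Real.exp (-(ℓ / (2000000 * Y ^ 2))) * (a : ℝ) ^ (2 : ℝ) := hexp
    _ = (a : ℝ) ^ 2 * Real.exp (-(ℓ / (2000000 * Y ^ 2))) := by rw [Real.rpow_two]; ring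

set_option maxHeartbeats 4000000 in
/-- **The Vinogradov–Korobov bound for `U(n)`** (Ivić (6.41)–(6.46), inexplicit constants).  Assume Vinogradov's
mean value theorem in the form `VMVTBound A` (spelled out as the hypothesis `hV`), `A ≥ 1`.  Let `ℓ = log N`,
`t = e^{Yℓ} ≥ 1` with `10.5 ≤ Y`, `Y² ≤ ℓ`, `N < n ≤ 2N`, `0 < u ≤ 1`, `r = ⌊5.05Y⌋ + 1`, `a = ⌊N^{2/5}⌋`, and let
`ℓ` satisfy the conditions of `eventually_conditions`.  Then
`|∑_{x ≤ a} ∑_{y ≤ a} e(∑_{m ≤ r} α_m(n)(xy)^m)| ≤ a² exp(−ℓ/(2·10⁶ Y²))`, `α_m(n) = (−1)^m t/(2πm(n+u)^m)`.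
Proof: `core_bound` with `k = 7r²`; `J_{k,r}(a) ≤ (Ar)^{42Ar³} a^{2k−h+hδ}` (`h = ½(r²+r)`, `δ = (1−1/r)^{6r} ≤ e^{−6}`);
`log G_m ≤ 2 log(2ka^m+1) ≤ 2 log(3k) + 2m log a` for every `m`, and `− 0.18Yℓ` better for the `≥ ⌊Y⌋` indices
`m ∈ (⌊3Y⌋, ⌊3Y⌋ + ⌊Y⌋]` (`log_sum_geomBound_good_le`); in the sum the powers of `a` cancel up to `a^{8k²+2hδ}`, and
`2hδ log a + 84Ar³ log(Ar) + 2r log(3k) − 0.18Yℓ⌊Y⌋ ≤ −0.089 Y²ℓ ≤ −4k² ℓ/(2·10⁶Y²)`.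
[cite: Ivic1985, Theorem 6.2 (proof), (6.41)–(6.46)] -/
theorem U_bound {A : ℝ} (hA : 1 ≤ A)
    (hV : ∀ (n ρ k P : ℕ), 2 ≤ n → n ^ 2 + n * ρ ≤ k →
      (A * n) ^ (A * n * (1 + 1 / ((n : ℝ) - 1)) ^ ρ) ≤ (P : ℝ) →
        (VMV.J n k (Finset.Icc (1 : ℤ) P) : ℝ) ≤
          (A * n) ^ (A * k * ρ) * (P : ℝ) ^ (2 * (k : ℝ) - ((n : ℝ) ^ 2 + n) / 2 * (1 - (1 - 1 / (n : ℝ)) ^ ρ)))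
    {N n r a : ℕ} {t u ℓ Y : ℝ}
    (hℓ : Real.log N = ℓ) (hYℓt : Y * ℓ = Real.log t) (ht1 : 1 ≤ t)
    (hNn : N < n) (hn2 : n ≤ 2 * N) (hu0 : 0 < u) (hu1 : u ≤ 1)
    (hY : 10.5 ≤ Y) (hY2 : Y ^ 2 ≤ ℓ)
    (hr : r = ⌊5.05 * Y⌋₊ + 1) (ha : a = ⌊(N : ℝ) ^ (2 / 5 : ℝ)⌋₊)
    (c1 : 2300 ≤ ℓ) (c2 : Real.log ℓ + 34 ≤ ℓ / 11)
    (c3 : 11475 * A * (Real.sqrt ℓ * Real.log (5.15 * A * Real.sqrt ℓ)) ≤ ℓ / 100)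
    (c4 : 1030 * Real.log (557 * ℓ) ≤ 10.5 * ℓ)
    (c5 : A * Real.exp 12 * 5.15 * (Real.sqrt ℓ * Real.log (5.15 * A * Real.sqrt ℓ)) ≤ 0.4 * ℓ - 1)
    (c6 : 557 * ℓ ≤ Real.exp (8.4 * ℓ)) :
    ‖∑ x ∈ Finset.Icc (1 : ℤ) a, ∑ y ∈ Finset.Icc (1 : ℤ) a,
        e (∑ j : Fin r, ((-1) ^ (j.val + 1) * t / (2 * π * ((j.val : ℝ) + 1) * ((n : ℝ) + u) ^ (j.val + 1))) *
          ((x : ℝ) ^ (j.val + 1) * (y : ℝ) ^ (j.val + 1)))‖ ≤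
      (a : ℝ) ^ 2 * Real.exp (-(ℓ / (2000000 * Y ^ 2))) :=
  U_bound_of_instance hA (fun n P hn hP => hV n (6 * n) (7 * n ^ 2) P hn (le_of_eq (by ring)) hP)
    hℓ hYℓt ht1 hNn hn2 hu0 hu1 hY hY2 hr ha c1 c2 c3 c4 c5 c6

end VinogradovZetaSum
end Literature.NumberTheory.LFunctions
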